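import Literature.Computability.Complexity.TVMatrixStr
import Literature.Computability.Complexity.HardLangMachine
import HarnessLib

/-!
# `FP` bricks for Trevisan–Vadhan's oracle machine, I: field arithmetic relative to a carried modulus,
# the literal factor and the two operators of the downward step

Literature / complexity — derandomization (Case 2 of IW98 in TV07 form), first MACHINE layer over the
string model `TVMatrixStr.lean` (`litFactorStr`, `opQuantStr`, `opLinStr` on `GF2Str.bits`), in the `FP` brick
algebra of `HardLangMachine.lean` (`xorF`: addition; `fmulOpF ⟨acc, ⟨b, f⟩⟩`: multiplication modulo the
MODULUS `f` carried in the input — the machine is uniform in the field size, so `f = modStr M` and the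
constant `1 = 1 0^M` are read off / built from the record, never hard-wired). Records here are
`⟨args, f⟩`; the combinators take sub-bricks reading the same record:

* `TVBrick.modOf`, `TVBrick.oneOf` (`bits M 1` from `|f| = M + 2`), `TVBrick.mulB A B`
  (`fmulStr M (A w) (B w)`), `TVBrick.xorB A B` (`xorStr`), each with `_mem_FP` and `_apply`;
* **`TVBrick.litF`** on `⟨⟨y, ⟨x, z⟩⟩, f⟩`: `litFactorStr M y x z` (`litF_apply`);
* **`TVBrick.opQuantF`** on `⟨⟨s, ⟨V₀, V₁⟩⟩, f⟩`: `opQuantStr M s V₀ V₁`; **`TVBrick.opLinF`** on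
  `⟨⟨ξ, ⟨V₀, V₁⟩⟩, f⟩`: `opLinStr M ξ V₀ V₁` (`opQuantF_apply`, `opLinF_apply`) — with `opStr_bits`
  (`TVMatrixStr.lean`) these are the bits of `opValue`, the arithmetic of one downward step of `F`
  (`TVFunction.Fni_eq_of_queries`).

Everything is proved; definitions are `FP` string functions (no named facts). The folds (clause, matrix)
and the query layout are the next file.

## References

* [TrevisanVadhan2007] L. Trevisan, S. Vadhan, Comput. Complexity 16 (2007), Lemma 4.1 (i), Thm. 4.3.
* [AroraBarakCC2009] S. Arora, B. Barak, CUP 2009, §1.3 (composition of polynomial-time computations).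
-/

noncomputable section

namespace Literature.Computability.Complexity

namespace TVBrick

open _root_.Computability Brick Plumb GF2Str HardLangM Literature.InformationTheory.Coding

variable (M : ℕ)

/-! ### Reading the modulus; the constant `1` -/

/-- The modulus field of a record `⟨args, f⟩`. [folklore] -/
def modOf : List Bool → List Bool := sndF

/-- `modOf ∈ FP`. [folklore] -/
theorem modOf_mem_FP : modOf ∈ FP := sndF_mem_FP

/-- **The constant `1 = 1 0^M`**, built from the modulus length `|f| = M + 2`. [folklore] -/
def oneOf : List Bool → List Bool :=
  appF ∘ fanoutFn (fun _ => [true]) (Kannan.zerosFn ∘ dropFn ∘ fanoutFn (fun _ => [true, true]) modOf)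

/-- `oneOf ∈ FP`. [folklore] -/
theorem oneOf_mem_FP : oneOf ∈ FP :=
  comp_mem_FP appF_mem_FP (fanoutFn_mem_FP (const_mem_FP _) (comp_mem_FP Kannan.zerosFn_mem_FP
    (comp_mem_FP dropFn_mem_FP (fanoutFn_mem_FP (const_mem_FP _) modOf_mem_FP))))

/-- Value of `oneOf` on a record with modulus `modStr M`. [folklore] -/
theorem oneOf_apply (args : List Bool) : oneOf (boolPair args (modStr M)) = bits M 1 := by
  simp only [oneOf, modOf, Function.comp_apply, fanoutFn_apply, sndF_boolPair, dropFn_boolPair, Kannan.zerosFn_apply,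
    List.length_drop, (modStr_top M).1, appF_boolPair, List.length_cons, List.length_nil, List.singleton_append, bits_one]
  rw [show M + 1 + 1 - (0 + 1 + 1) = M by omega]

/-! ### Multiplication and addition of sub-brick values -/

/-- **Product of two sub-bricks** modulo the carried modulus: `fmulOpF ⟨A w, ⟨B w, f⟩⟩`. [folklore] -/
def mulB (A B : List Bool → List Bool) : List Bool → List Bool := fmulOpF ∘ fanoutFn A (fanoutFn B modOf)

/-- `mulB A B ∈ FP`. [folklore] -/
theorem mulB_mem_FP {A B : List Bool → List Bool} (hA : A ∈ FP) (hB : B ∈ FP) : mulB A B ∈ FP :=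
  comp_mem_FP fmulOpF_mem_FP (fanoutFn_mem_FP hA (fanoutFn_mem_FP hB modOf_mem_FP))

/-- Value of the product on a record with modulus `modStr M`. [folklore] -/
theorem mulB_apply (A B : List Bool → List Bool) (args : List Bool) :
    mulB A B (boolPair args (modStr M)) = fmulStr M (A (boolPair args (modStr M))) (B (boolPair args (modStr M))) := by
  simp only [mulB, modOf, Function.comp_apply, fanoutFn_apply, sndF_boolPair, fmulOpF_apply_mod]

/-- **Sum of two sub-bricks** (bitwise xor). [folklore] -/
def xorB (A B : List Bool → List Bool) : List Bool → List Bool := xorF ∘ fanoutFn A B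

/-- `xorB A B ∈ FP`. [folklore] -/
theorem xorB_mem_FP {A B : List Bool → List Bool} (hA : A ∈ FP) (hB : B ∈ FP) : xorB A B ∈ FP :=
  comp_mem_FP xorF_mem_FP (fanoutFn_mem_FP hA hB)

/-- Value of the sum. [folklore] -/
theorem xorB_apply (A B : List Bool → List Bool) (w : List Bool) : xorB A B w = xorStr (A w) (B w) := by
  simp only [xorB, Function.comp_apply, fanoutFn_apply, xorF_apply]

/-! ### The literal factor -/

/-- First argument of `⟨⟨a, ⟨b, c⟩⟩, f⟩`. [folklore] -/
def arg0 : List Bool → List Bool := fstF ∘ fstF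
/-- Second argument of `⟨⟨a, ⟨b, c⟩⟩, f⟩`. [folklore] -/
def arg1 : List Bool → List Bool := fstF ∘ sndF ∘ fstF
/-- Third argument of `⟨⟨a, ⟨b, c⟩⟩, f⟩`. [folklore] -/
def arg2 : List Bool → List Bool := sndF ∘ sndF ∘ fstF

/-- `arg0 ∈ FP`. [folklore] -/
theorem arg0_mem_FP : arg0 ∈ FP := comp_mem_FP fstF_mem_FP fstF_mem_FP
/-- `arg1 ∈ FP`. [folklore] -/
theorem arg1_mem_FP : arg1 ∈ FP := comp_mem_FP fstF_mem_FP (comp_mem_FP sndF_mem_FP fstF_mem_FP)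
/-- `arg2 ∈ FP`. [folklore] -/
theorem arg2_mem_FP : arg2 ∈ FP := comp_mem_FP sndF_mem_FP (comp_mem_FP sndF_mem_FP fstF_mem_FP)

/-- Values of the argument readers. [folklore] -/
theorem args_apply (a b c f : List Bool) :
    arg0 (boolPair (boolPair a (boolPair b c)) f) = a ∧ arg1 (boolPair (boolPair a (boolPair b c)) f) = b ∧
      arg2 (boolPair (boolPair a (boolPair b c)) f) = c := by
  simp [arg0, arg1, arg2]

/-- **The literal-factor brick** on `⟨⟨y, ⟨x, z⟩⟩, f⟩`: `(1 + y·x)(1 + z(1 + x))`.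
[cite: TrevisanVadhan2007, Lemma 4.1 (i)] -/
def litF : List Bool → List Bool :=
  mulB (xorB oneOf (mulB arg0 arg1)) (xorB oneOf (mulB arg2 (xorB oneOf arg1)))

/-- `litF ∈ FP`. [folklore] -/
theorem litF_mem_FP : litF ∈ FP :=
  mulB_mem_FP (xorB_mem_FP oneOf_mem_FP (mulB_mem_FP arg0_mem_FP arg1_mem_FP))
    (xorB_mem_FP oneOf_mem_FP (mulB_mem_FP arg2_mem_FP (xorB_mem_FP oneOf_mem_FP arg1_mem_FP)))

/-- **Value of the literal-factor brick**: `litFactorStr`. [cite: TrevisanVadhan2007, Lemma 4.1 (i)] -/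
theorem litF_apply (y x z : List Bool) :
    litF (boolPair (boolPair y (boolPair x z)) (modStr M)) = QBFUniv.litFactorStr M y x z := by
  obtain ⟨h0, h1, h2⟩ := args_apply y x z (modStr M)
  simp only [litF, mulB_apply, xorB_apply, oneOf_apply, h0, h1, h2, QBFUniv.litFactorStr, QBFUniv.oneStr]

/-! ### The two operators of the downward step -/

/-- **The selected-quantifier brick** on `⟨⟨s, ⟨V₀, V₁⟩⟩, f⟩`: `s·(V₀V₁) + (1+s)(1 + (1+V₀)(1+V₁))`.
[cite: TrevisanVadhan2007, Lemma 4.1 (i)] -/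
def opQuantF : List Bool → List Bool :=
  xorB (mulB arg0 (mulB arg1 arg2))
    (mulB (xorB oneOf arg0) (xorB oneOf (mulB (xorB oneOf arg1) (xorB oneOf arg2))))

/-- `opQuantF ∈ FP`. [folklore] -/
theorem opQuantF_mem_FP : opQuantF ∈ FP :=
  xorB_mem_FP (mulB_mem_FP arg0_mem_FP (mulB_mem_FP arg1_mem_FP arg2_mem_FP))
    (mulB_mem_FP (xorB_mem_FP oneOf_mem_FP arg0_mem_FP)
      (xorB_mem_FP oneOf_mem_FP (mulB_mem_FP (xorB_mem_FP oneOf_mem_FP arg1_mem_FP) (xorB_mem_FP oneOf_mem_FP arg2_mem_FP))))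

/-- **Value of the selected-quantifier brick**: `opQuantStr`. [cite: TrevisanVadhan2007, Lemma 4.1 (i)] -/
theorem opQuantF_apply (s V0 V1 : List Bool) :
    opQuantF (boolPair (boolPair s (boolPair V0 V1)) (modStr M)) = QBFUniv.opQuantStr M s V0 V1 := by
  obtain ⟨h0, h1, h2⟩ := args_apply s V0 V1 (modStr M)
  simp only [opQuantF, mulB_apply, xorB_apply, oneOf_apply, h0, h1, h2, QBFUniv.opQuantStr, QBFUniv.oneStr]

/-- **The linearization brick** on `⟨⟨ξ, ⟨V₀, V₁⟩⟩, f⟩`: `(1+ξ)V₀ + ξV₁`. [cite: TrevisanVadhan2007, Lemma 4.1 (i)] -/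
def opLinF : List Bool → List Bool :=
  xorB (mulB (xorB oneOf arg0) arg1) (mulB arg0 arg2)

/-- `opLinF ∈ FP`. [folklore] -/
theorem opLinF_mem_FP : opLinF ∈ FP :=
  xorB_mem_FP (mulB_mem_FP (xorB_mem_FP oneOf_mem_FP arg0_mem_FP) arg1_mem_FP) (mulB_mem_FP arg0_mem_FP arg2_mem_FP)

/-- **Value of the linearization brick**: `opLinStr`. [cite: TrevisanVadhan2007, Lemma 4.1 (i)] -/
theorem opLinF_apply (xi V0 V1 : List Bool) :
    opLinF (boolPair (boolPair xi (boolPair V0 V1)) (modStr M)) = QBFUniv.opLinStr M xi V0 V1 := by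
  obtain ⟨h0, h1, h2⟩ := args_apply xi V0 V1 (modStr M)
  simp only [opLinF, mulB_apply, xorB_apply, oneOf_apply, h0, h1, h2, QBFUniv.opLinStr, QBFUniv.oneStr]

/-- **The downward-step arithmetic on field elements**: with the bits of the selector / coordinate and of
the two reassembled values, the operator bricks spell the bits of `opValue`. [cite: TrevisanVadhan2007, Lemma 4.1 (i)] -/
theorem opF_bits {n : ℕ} (o : QBFUniv.UOp n) (x : Fin (QBFUniv.N n) → QBFUniv.K n) (v0 v1 : QBFUniv.K n) :
    (match o with
      | .quant k => opQuantF (boolPair (boolPair (bits (QBFUniv.Mof n) (x (QBFUniv.lay n (.s k))))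
          (boolPair (bits (QBFUniv.Mof n) v0) (bits (QBFUniv.Mof n) v1))) (modStr (QBFUniv.Mof n)))
      | .lin i => opLinF (boolPair (boolPair (bits (QBFUniv.Mof n) (x i))
          (boolPair (bits (QBFUniv.Mof n) v0) (bits (QBFUniv.Mof n) v1))) (modStr (QBFUniv.Mof n)))) =
      bits (QBFUniv.Mof n) (QBFUniv.opValue o x v0 v1) := by
  rw [← QBFUniv.opStr_bits]
  cases o with
  | quant k => exact opQuantF_apply _ _ _ _
  | lin i => exact opLinF_apply _ _ _ _

end TVBrick

end Literature.Computability.Complexity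

end
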